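import Summits.HodgeConjecture.HodgeConjecture.Theorems.F0P3SpectralJunction
import Summits.HodgeConjecture.CorCM.Hyp413.A3Liu413FaceTypes
import Summits.HodgeConjecture.HodgeConjecture.Theorems.HCCMUnconditionalH411
import Literature.NumberTheory.Rogawski1990.CohomologicalSpectrumInnerForm
import HarnessLib

/-!
# Crux `H413`, line `F0_U3CohMultOne` — STUB S5 (Hodge-type exclusion at the pin) FOLDED onto the engine letter E2′

Floor-0 programme P3 «U3-mult», seat F0P3-p02 (g0); crux item stmt-HodgeConjecture-24833 (`HCCMUnconditional.H413`); line
`Cruxes/H413/Lines/F0_U3CohMultOne.lean` v1.1/v1.2, stub S5 `stub_S5_hodgeTypeExclusionAt : StubS5HodgeTypeExclusionAt` (ll. 239–251).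
HC_CM is proved only modulo the printed citations until rung 0 closes.

`stubS5_of` proves the registered stub TYPE `StubS5HodgeTypeExclusionAt` — restated TOKEN-IDENTICALLY as the conclusion — from
* the engine letter E2′ ★ `Literature.NumberTheory.Rogawski1990.hodgeTypeRigid` BY NAME ([Rogawski1990, Thm. 13.3.6 (c), §15.3 ¶1, §12.3,
  Thm. 14.6.4, Thm. 13.3.5]: no irreducible smooth `σ` is the finite component of both a `(1,0)`-type and a `(0,1)`-type discrete `P`);
* the analytic junction letter TP «the spectral projection onto an irreducible summand of `L²_d` preserves the (anti)holomorphic cotangent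
  type» (hypotheses `hTPhol`, `hTPantihol`, spelled with the binder prefix of the letters (B); requested from the typer on the cell bus
  2026-08-30T21:53Z; [BorelJacquet1979, §4.6] + Gårding + Weyl's lemma — the ONE analytic input beyond E2′; it follows from the integrator's
  typed spectral decomposition U2a⁺ together with E1 `innerFormMultiplicityLeOne` and orthogonality of inequivalent irreducibles);
* continuity of the cohomological cotangent forms of the factor of record on `U(V)(𝔸_{F⁺})` (hypothesis `hcont`; the content of programme P2's
  registered stub U2ℓ `StubU2lL2Realisation`, cf. ★-pending `Theorems/H413SpectrumJunction.continuous_of_continuous_descent`);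
and, sorry-free in the tree: the formal `L²` junction J1′ ★ `Theorems/F0P3SpectralJunction` (projection route `pr_P ∘ [·] ∘ ψ`), the adjectives
of `ω_V(t)` ★ `Theorems.H411_proof` ([Liu2021, Def. 4.11] as printed: irreducible-or-zero and smooth), the existence of an automorphic measure and
the compactness / discrete decomposability of `L²(U(V)(F⁺)\U(V)(𝔸_{F⁺}))` (★ `AdelicUnitaryGroupSpectrum`, from `6 ≤ [F:ℚ]`).

PROOF (classical).  If both an equivariant `holCotForms 𝔞₀`-valued `ψ ≠ 0` and an equivariant `conj(holCotForms 𝔞₀)`-valued `ψ′ ≠ 0` existed out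
of `ω_V(t)`, then `ω_V(t) ≠ 0` is irreducible and smooth; at ONE automorphic `μ`, J1′ gives discrete `P`, `P′ ≤ L²(μ)` meeting the classes of
`ψ w`, `ψ′ w′` and having finite component `ω_V(t)`; TP makes `P` of type `(1,0)` and `P′` of type `(0,1)`; E2′ (at the pin `(K F, ι₁, Hm V,
V.sylvesterFrame, sylvesterFrame_J V, V.posDef_of_ne)`, `2 ≤ [F⁺:ℚ]` from `6 ≤ [F:ℚ]`) says no.

References: [Rogawski1990] Ann. of Math. Stud. 123: Thm. 13.3.6 (c), §15.3 ¶1, §12.3 p. 174, Thm. 14.6.4, Thm. 13.3.5; [BorelJacquet1979] §4.6;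
[Liu2021] arXiv:2102.11518, proof of Prop. 4.13 l. 2140–2146, Lem. D.2 (2), Def. 4.11; [Marshall2014] §3.3.
-/

-- the mandated namespace has the single-problem summit's repeated segment (`HodgeConjecture.HodgeConjecture`), as in every
-- `Theorems/*.lean` of this sub-problem
set_option linter.dupNamespace false

noncomputable section

namespace Summit.HodgeConjecture.HodgeConjecture.Cruxes.H413.F0P3StubS5Fold

open scoped TensorProduct Matrix InnerProductSpace ENNReal ComplexOrder
open MeasureTheory
open NumberField NumberField.InfinitePlace IsDedekindDomain
open HodgeCM.Model HodgeCM.Model.LiuIndex HodgeCM.Model.TowerCarrier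
open Summit.HodgeConjecture.CorCM.Model
open Literature.AlgebraicGeometry.Motives (CMType AbelianVariety)
open Literature.AlgebraicGeometry.HodgeTheory Literature.NumberTheory.Automorphic.PicardCM
open Literature.AlgebraicGeometry.ShimuraVarieties Literature.AlgebraicGeometry.ShimuraVarieties.UnitaryCanonicalModel
open Literature.NumberTheory.ComplexMultiplication
open Literature.NumberTheory.Automorphic
open Literature.NumberTheory.Automorphic.Liu2021 Literature.NumberTheory.Automorphic.Liu2021.AppendixC
open Literature.NumberTheory.Automorphic.Liu2021.Def411WeilCarriers (lineOf locF Rep)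
open Summit.HodgeConjecture.CorCM.Transposition.OmegaTransport (realUnit)
open HodgeCM.Model.ArchSideTerm (e₁)
open Literature.NumberTheory.GelbartRogawski1991 Literature.NumberTheory.GelbartRogawski1991.UnitaryDualPair
open Literature.RepresentationTheory Literature.RepresentationTheory.Liu2021
open Summit.HodgeConjecture.CorCM
open Summit.HodgeConjecture.CorCM.Transposition
open Literature.NumberTheory.GelbartRogawski1991.OscillatorTripleDictionary (OccursInH1 IsIsoToOmega)
open Summit.HodgeConjecture.HodgeConjecture.Theses (HCCMUnconditional.HDel)
open MulAction
open Literature.Geometry.ComplexHyperbolic.BallModel (U21 x₀)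
open Literature.NumberTheory.GelbartRogawski1991.OscillatorTripleDictionary (rhoTriple)
open Summit.HodgeConjecture.CorCM.Lines.A3Liu413 (datum413)
open Summit.HodgeConjecture.HodgeConjecture.Cruxes.H413.CohFormsCarriers
open Literature.NumberTheory.Automorphic.UnitaryGroup
open Literature.NumberTheory.Automorphic.UnitaryGroup.CotangentForms (toQuotFun cmArchSection cmCompactFactor)
open Summit.HodgeConjecture.HodgeConjecture.Cruxes.H413.F0P3SpectralJunction
open Summit.HodgeConjecture.HodgeConjecture.Cruxes.H413.F0P3HilbertProjection
open Summit.HodgeConjecture.HodgeConjecture.Cruxes.H413.SpectrumJunction (continuous_toQuotFun compactSpace_automorphicQuotient_adelicDatum)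

/-- `[F⁺:ℚ] ≥ 2` for a CM field with `6 ≤ [F:ℚ]` (`[F:ℚ] = 2 [F⁺:ℚ]`): the «genuine inner form» hypothesis of the letters (B). [folklore] -/
theorem two_le_finrank_maximalRealSubfield (F : HodgeCM.CMField) (h6 : 6 ≤ Module.finrank ℚ F) :
    2 ≤ Module.finrank ℚ ↥(maximalRealSubfield (HodgeCM.CMField.K F)) := by
  have h := Module.finrank_mul_finrank ℚ ↥(maximalRealSubfield (HodgeCM.CMField.K F)) (HodgeCM.CMField.K F)
  rw [Algebra.IsQuadraticExtension.finrank_eq_two ↥(maximalRealSubfield (HodgeCM.CMField.K F)) (HodgeCM.CMField.K F)] at h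
  change _ = Module.finrank ℚ F at h
  omega

set_option synthInstance.maxHeartbeats 400000 in
set_option maxHeartbeats 8000000 in
/-- **THE S5 FOLD — Hodge-type exclusion at the pin from the engine letter E2′ (★ `hodgeTypeRigid`, by name), the analytic junction letter TP and
the continuity of cotangent forms.**  Conclusion = the registered stub TYPE `StubS5HodgeTypeExclusionAt` of `Cruxes/H413/Lines/F0_U3CohMultOne.lean`
v1.1 (ll. 239–251) TOKEN-IDENTICALLY.  `hTPhol`/`hTPantihol`: «a discrete `P` NOT ORTHOGONAL to (the class of a coordinate of) a holomorphic resp.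
antiholomorphic cotangent form CONTAINS a non-zero one» (`IsHolCotangentAt` / `IsAntiholCotangentAt`), binder prefix of the letters (B); `hcont`: the
cohomological cotangent forms of the factor of record are continuous on `U(V)(𝔸_{F⁺})` (programme P2's U2ℓ).  Proof in the module docstring.
HC_CM is proved only modulo the printed citations until rung 0 closes. [cite: Rogawski1990, Thm. 13.3.6 (c); §15.3 ¶1; §12.3 p. 174; Thm. 14.6.4;
Thm. 13.3.5] [cite: BorelJacquet1979, §4.6] [cite: Liu2021, proof of Prop. 4.13, l. 2140–2146; Lem. D.2 (2)] -/
theorem stubS5_of (hE2' : Literature.NumberTheory.Rogawski1990.hodgeTypeRigid)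
    (hTPhol : ∀ (L : Type) [Field L] [NumberField L] [IsCMField L] (ι : L →+* ℂ) (H : Matrix (Fin 3) (Fin 3) L) (T : GL (Fin 3) ℂ)
      (hT : (T : Matrix (Fin 3) (Fin 3) ℂ)ᴴ * H.map ι * (T : Matrix (Fin 3) (Fin 3) ℂ) = Literature.Geometry.ComplexHyperbolic.BallModel.J),
      (∀ τ' : L →+* ℂ, InfinitePlace.mk τ' ≠ InfinitePlace.mk ι → (H.map τ').PosDef) →
      2 ≤ Module.finrank ℚ ↥(maximalRealSubfield L) →
      ∀ (μ : Measure (adelicGroupData (↥(maximalRealSubfield L)) L (IsCMField.complexConj L) 3 H).automorphicQuotient)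
        [(adelicGroupData (↥(maximalRealSubfield L)) L (IsCMField.complexConj L) 3 H).IsAutomorphicMeasure μ]
        (P : DiscreteAutomorphicRep (adelicGroupData (↥(maximalRealSubfield L)) L (IsCMField.complexConj L) 3 H) μ)
        (Φ : (adelicGroupData (↥(maximalRealSubfield L)) L (IsCMField.complexConj L) 3 H).Adelic → (Fin 2 → ℂ)),
        Φ ∈ CotangentForms.holCotForms (↥(maximalRealSubfield L)) L (IsCMField.complexConj L) 3 H (cmArchSection L ι H T hT)
          (cmCompactFactor L ι H T hT) →
        ∀ (h : ∀ j : Fin 2, MemLp (toQuotFun (adelicGroupData (↥(maximalRealSubfield L)) L (IsCMField.complexConj L) 3 H)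
          fun x => Φ x j) 2 μ),
        (∃ (j : Fin 2), ∃ u ∈ P.space,
          ⟪(u : (adelicGroupData (↥(maximalRealSubfield L)) L (IsCMField.complexConj L) 3 H).L2 μ), (h j).toLp⟫_ℂ ≠ 0) →
        P.IsHolCotangentAt (cmArchSection L ι H T hT) (cmCompactFactor L ι H T hT))
    (hTPantihol : ∀ (L : Type) [Field L] [NumberField L] [IsCMField L] (ι : L →+* ℂ) (H : Matrix (Fin 3) (Fin 3) L) (T : GL (Fin 3) ℂ)
      (hT : (T : Matrix (Fin 3) (Fin 3) ℂ)ᴴ * H.map ι * (T : Matrix (Fin 3) (Fin 3) ℂ) = Literature.Geometry.ComplexHyperbolic.BallModel.J),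
      (∀ τ' : L →+* ℂ, InfinitePlace.mk τ' ≠ InfinitePlace.mk ι → (H.map τ').PosDef) →
      2 ≤ Module.finrank ℚ ↥(maximalRealSubfield L) →
      ∀ (μ : Measure (adelicGroupData (↥(maximalRealSubfield L)) L (IsCMField.complexConj L) 3 H).automorphicQuotient)
        [(adelicGroupData (↥(maximalRealSubfield L)) L (IsCMField.complexConj L) 3 H).IsAutomorphicMeasure μ]
        (P : DiscreteAutomorphicRep (adelicGroupData (↥(maximalRealSubfield L)) L (IsCMField.complexConj L) 3 H) μ)
        (Φ : (adelicGroupData (↥(maximalRealSubfield L)) L (IsCMField.complexConj L) 3 H).Adelic → (Fin 2 → ℂ)),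
        Φ ∈ (CotangentForms.holCotForms (↥(maximalRealSubfield L)) L (IsCMField.complexConj L) 3 H (cmArchSection L ι H T hT)
          (cmCompactFactor L ι H T hT)).map (CotangentForms.conjFun (↥(maximalRealSubfield L)) L (IsCMField.complexConj L) 3 H) →
        ∀ (h : ∀ j : Fin 2, MemLp (toQuotFun (adelicGroupData (↥(maximalRealSubfield L)) L (IsCMField.complexConj L) 3 H)
          fun x => Φ x j) 2 μ),
        (∃ (j : Fin 2), ∃ u ∈ P.space,
          ⟪(u : (adelicGroupData (↥(maximalRealSubfield L)) L (IsCMField.complexConj L) 3 H).L2 μ), (h j).toLp⟫_ℂ ≠ 0) →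
        P.IsAntiholCotangentAt (cmArchSection L ι H T hT) (cmCompactFactor L ι H T hT))
    (hcont : ∀ (F : HodgeCM.CMField) {ι₁ : F →+* ℂ} (V : HodgeCM.HermSpace3 F ι₁), 4 ≤ Module.finrank ℚ F →
      ∀ f ∈ cohForms (archFactorOf F V), ∀ j : Fin 2, Continuous fun x => f x j) :
    ∀ (hDel : Literature.AlgebraicGeometry.ShimuraVarieties.UnitaryCanonicalModel.canonicalModel_exists_printed)
      (F : HodgeCM.CMField) [IsGalois ℚ F] (h6 : 6 ≤ Module.finrank ℚ F) {ι₁ : F →+* ℂ} (V : HodgeCM.HermSpace3 F ι₁) (a₀ : RealScalar F)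
      (Φ : CMType F) (hΦ : ι₁ ∈ Φ.1) (i : (I V (repAt a₀) (muLiu ι₁ GramClass.rep))),
      3 ≤ (datum413 hDel F V a₀ Φ i).n → ∀ t : (datum413 hDel F V a₀ Φ i).AdmTriple,
        (∀ ψ : (datum413 hDel F V a₀ Φ i).omegaAt t →ₗ[ℂ] ((adelicDatum F V).Adelic → (Fin 2 → ℂ)),
            (∀ (g : ↥(HodgeCM.HermSpace3.adelicFin V)) (w : (datum413 hDel F V a₀ Φ i).omegaAt t),
                ψ ((datum413 hDel F V a₀ Φ i).rhoAt t g w) = rightRep F V g (ψ w)) →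
              (∀ w, ψ w ∈ holCotForms (archFactorOf F V)) → ψ = 0) ∨
        (∀ ψ : (datum413 hDel F V a₀ Φ i).omegaAt t →ₗ[ℂ] ((adelicDatum F V).Adelic → (Fin 2 → ℂ)),
            (∀ (g : ↥(HodgeCM.HermSpace3.adelicFin V)) (w : (datum413 hDel F V a₀ Φ i).omegaAt t),
                ψ ((datum413 hDel F V a₀ Φ i).rhoAt t g w) = rightRep F V g (ψ w)) →
              (∀ w, ψ w ∈ (holCotForms (archFactorOf F V)).map (conjFun F V)) → ψ = 0) := by
  intro hDel F _ h6 ι₁ V a₀ Φ hΦ i hn t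
  by_contra hcon
  push Not at hcon
  obtain ⟨⟨ψ, hψe, hψv, hψ0⟩, ⟨ψ', hψ'e, hψ'v, hψ'0⟩⟩ := hcon
  have h4 : 4 ≤ Module.finrank ℚ F := le_trans (by norm_num) h6
  have h2 := two_le_finrank_maximalRealSubfield F h6
  -- ONE automorphic measure for both halves
  obtain ⟨μ, hμ⟩ := exists_isAutomorphicMeasure (V := V) h4
  haveI := hμ
  -- `ω_V(t)` is non-zero (as `ψ ≠ 0`), hence irreducible, and smooth: ★ `H411_proof` ([Liu2021, Def. 4.11] as printed at the pin)
  obtain ⟨w₁, hw₁⟩ : ∃ w, ψ w ≠ 0 := by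
    by_contra h
    push Not at h
    exact hψ0 (LinearMap.ext h)
  haveI : Nontrivial ((datum413 hDel F V a₀ Φ i).omegaAt t) :=
    ⟨⟨w₁, 0, fun h => hw₁ (by rw [h, map_zero])⟩⟩
  have hadj := Summit.HodgeConjecture.HodgeConjecture.Theorems.H411_proof hDel F h6 V (repAt a₀ (Sigma.fst i)) Φ hΦ
    t.1.μ t.1.isConjugateSymplectic t.2.1 t.1.ε t.1.χ
  have hirr : ((datum413 hDel F V a₀ Φ i).rhoAt t).IsIrreducible := isIrreducible_of_nontrivial hadj.1
  have hsm : ((datum413 hDel F V a₀ Φ i).rhoAt t).IsSmooth := fun v => by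
    obtain ⟨S, hS, hfix⟩ := hadj.2.1 v
    exact Representation.isSmoothVector_of_le _ hS fun k hk => hfix k hk
  -- the junction J1′, twice (same `μ`)
  obtain ⟨P, w, j, h, hu, hfin⟩ := exists_discreteAutomorphicRep_of_equivariant_cohForms h4 μ (archFactorOf F V)
    (hcont F V h4) ((datum413 hDel F V a₀ Φ i).rhoAt t) hirr ψ hψe
    (fun w => show ψ w ∈ holCotForms (archFactorOf F V) ⊔ _ from Submodule.mem_sup_left (hψv w)) hψ0
  obtain ⟨P', w', j', h', hu', hfin'⟩ := exists_discreteAutomorphicRep_of_equivariant_cohForms h4 μ (archFactorOf F V)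
    (hcont F V h4) ((datum413 hDel F V a₀ Φ i).rhoAt t) hirr ψ' hψ'e
    (fun w => show ψ' w ∈ _ ⊔ (holCotForms (archFactorOf F V)).map (conjFun F V) from Submodule.mem_sup_right (hψ'v w)) hψ'0
  -- all coordinates of cotangent forms are `L²` (continuity on the compact quotient)
  haveI := compactSpace_automorphicQuotient_adelicDatum F V h4
  have hmem : ∀ f ∈ cohForms (archFactorOf F V), ∀ j : Fin 2, MemLp (toQuotFun (adelicDatum F V) fun x => f x j) 2 μ :=
    fun f hf j => memLp_of_continuous (continuous_toQuotFun (cohForms_left_invariant_apply (archFactorOf F V) hf j) (hcont F V h4 f hf j))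
  -- the analytic letter TP: the two discrete representations have the two Hodge types
  have hP : P.IsHolCotangentAt (archFactorOf F V).ιinf (archFactorOf F V).Kc :=
    hTPhol (HodgeCM.CMField.K F) ι₁ (HodgeCM.HermSpace3.Hm V) V.sylvesterFrame (HodgeCM.Model.sylvesterFrame_J V) V.posDef_of_ne h2 μ
      P (ψ w) (hψv w) (hmem (ψ w) (Submodule.mem_sup_left (hψv w))) ⟨j, hu⟩
  have hP' : P'.IsAntiholCotangentAt (archFactorOf F V).ιinf (archFactorOf F V).Kc :=
    hTPantihol (HodgeCM.CMField.K F) ι₁ (HodgeCM.HermSpace3.Hm V) V.sylvesterFrame (HodgeCM.Model.sylvesterFrame_J V) V.posDef_of_ne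
      h2 μ P' (ψ' w') (hψ'v w') (hmem (ψ' w') (Submodule.mem_sup_right (hψ'v w'))) ⟨j', hu'⟩
  -- the engine letter E2′: impossible
  exact hE2' (HodgeCM.CMField.K F) ι₁ (HodgeCM.HermSpace3.Hm V) V.sylvesterFrame (HodgeCM.Model.sylvesterFrame_J V) V.posDef_of_ne h2 μ
    ((datum413 hDel F V a₀ Φ i).omegaAt t) ((datum413 hDel F V a₀ Φ i).rhoAt t) hirr hsm P P' hP hP' hfin hfin'


/-! ## The TP⁺ («representable») form of the analytic letter and its corollaries -/

section TPplus

open Literature.NumberTheory.Automorphic.UnitaryGroup.CotangentForms (holCotForms conjFun)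

variable {F₀ E : Type} [Field F₀] [NumberField F₀] [Field E] [NumberField E] [Algebra F₀ E]
  {c : E ≃ₐ[F₀] E} {N : ℕ} {J : Matrix (Fin N) (Fin N) E}
  {μ : Measure (adelicGroupData F₀ E c N J).automorphicQuotient}
  [SMulInvariantMeasure (adelicGroupData F₀ E c N J).Adelic (adelicGroupData F₀ E c N J).automorphicQuotient μ]

/-- **Detection from representability (generic corollary of TP⁺)**: if the `L²`-classes of the coordinates of some `Φ' ∈ A` lie in the discrete
`P` and one of them is non-zero, then `P` contains the non-zero form `Φ'` (`ContainsForm`), for ANY submodule `A` of forms — at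
`A = holCotForms …` this is `P.IsHolCotangentAt`, at `A = conj holCotForms …` it is `P.IsAntiholCotangentAt`. [cite: BorelJacquet1979, §4.6] -/
theorem exists_ne_zero_containsForm_of_classes (P : DiscreteAutomorphicRep (adelicGroupData F₀ E c N J) μ)
    {A : Submodule ℂ ((adelicGroupData F₀ E c N J).Adelic → (Fin 2 → ℂ))} {Φ' : (adelicGroupData F₀ E c N J).Adelic → (Fin 2 → ℂ)}
    (hΦ' : Φ' ∈ A) (h' : ∀ j : Fin 2, MemLp (toQuotFun (adelicGroupData F₀ E c N J) fun x => Φ' x j) 2 μ)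
    (hmem : ∀ j : Fin 2, ((h' j).toLp _ : (adelicGroupData F₀ E c N J).L2 μ) ∈ P.space)
    (hne : ∃ j : Fin 2, ((h' j).toLp _ : (adelicGroupData F₀ E c N J).L2 μ) ≠ 0) :
    ∃ Φ ∈ A, Φ ≠ 0 ∧ P.ContainsForm Φ := by
  refine ⟨Φ', hΦ', ?_, fun j => ⟨h' j, hmem j⟩⟩
  rintro rfl
  obtain ⟨j, hj⟩ := hne
  exact hj (MemLp.toLp_zero (h' j))

end TPplus

set_option synthInstance.maxHeartbeats 400000 in
set_option maxHeartbeats 8000000 in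
/-- **THE S5 FOLD FROM THE REPRESENTABLE LETTER TP⁺** (the lead's ruling F0/P3 bus 2026-08-30T22:05:21Z (2): letter (D)
`holCotFormSpectralProjection` ∕ `antiholCotFormSpectralProjection` of the typer, carried here as HYPOTHESES in the announced tokens —
`P.space.toSubmodule.starProjection` on `MemLp.toLp` of `toQuotFun`): «for every discrete `P` and every holomorphic (resp. antiholomorphic)
cotangent form `Φ` with `L²` coordinates, the orthogonal projections onto `P` of the classes of the coordinates of `Φ` are the classes of the
SAME coordinates of some holomorphic (resp. antiholomorphic) cotangent form `Φ_P`».  TP⁺ ⇒ the detection form of `stubS5_of` in five lines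
(`pr_P [Φ_j] ≠ 0 ⇒ Φ_P ≠ 0`, and `P.ContainsForm Φ_P` as the projections lie in `P`), whence S5; NO multiplicity-one input (E1) is used.
HC_CM is proved only modulo the printed citations until rung 0 closes. [cite: Rogawski1990, Thm. 13.3.6 (c); §15.3 ¶1; §12.3 p. 174;
Thm. 14.6.4; Thm. 13.3.5] [cite: BorelJacquet1979, §4.6] [cite: Liu2021, proof of Prop. 4.13, l. 2140–2146; Lem. D.2 (2)] -/
theorem stubS5_of_spectralProjection (hE2' : Literature.NumberTheory.Rogawski1990.hodgeTypeRigid)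
    (hTPhol : ∀ (L : Type) [Field L] [NumberField L] [IsCMField L] (ι : L →+* ℂ) (H : Matrix (Fin 3) (Fin 3) L) (T : GL (Fin 3) ℂ)
      (hT : (T : Matrix (Fin 3) (Fin 3) ℂ)ᴴ * H.map ι * (T : Matrix (Fin 3) (Fin 3) ℂ) = Literature.Geometry.ComplexHyperbolic.BallModel.J),
      (∀ τ' : L →+* ℂ, InfinitePlace.mk τ' ≠ InfinitePlace.mk ι → (H.map τ').PosDef) →
      2 ≤ Module.finrank ℚ ↥(maximalRealSubfield L) →
      ∀ (μ : Measure (adelicGroupData (↥(maximalRealSubfield L)) L (IsCMField.complexConj L) 3 H).automorphicQuotient)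
        [(adelicGroupData (↥(maximalRealSubfield L)) L (IsCMField.complexConj L) 3 H).IsAutomorphicMeasure μ]
        (P : DiscreteAutomorphicRep (adelicGroupData (↥(maximalRealSubfield L)) L (IsCMField.complexConj L) 3 H) μ)
        (Φ : (adelicGroupData (↥(maximalRealSubfield L)) L (IsCMField.complexConj L) 3 H).Adelic → (Fin 2 → ℂ)),
        Φ ∈ CotangentForms.holCotForms (↥(maximalRealSubfield L)) L (IsCMField.complexConj L) 3 H (cmArchSection L ι H T hT)
          (cmCompactFactor L ι H T hT) →
        ∀ (h : ∀ j : Fin 2, MemLp (toQuotFun (adelicGroupData (↥(maximalRealSubfield L)) L (IsCMField.complexConj L) 3 H)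
          fun x => Φ x j) 2 μ),
        ∃ Φ' ∈ CotangentForms.holCotForms (↥(maximalRealSubfield L)) L (IsCMField.complexConj L) 3 H (cmArchSection L ι H T hT)
          (cmCompactFactor L ι H T hT),
        ∃ h' : (∀ j : Fin 2, MemLp (toQuotFun (adelicGroupData (↥(maximalRealSubfield L)) L (IsCMField.complexConj L) 3 H)
          fun x => Φ' x j) 2 μ),
        ∀ j : Fin 2, P.space.toSubmodule.starProjection ((h j).toLp _) =
          ((h' j).toLp _ : (adelicGroupData (↥(maximalRealSubfield L)) L (IsCMField.complexConj L) 3 H).L2 μ))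
    (hTPantihol : ∀ (L : Type) [Field L] [NumberField L] [IsCMField L] (ι : L →+* ℂ) (H : Matrix (Fin 3) (Fin 3) L) (T : GL (Fin 3) ℂ)
      (hT : (T : Matrix (Fin 3) (Fin 3) ℂ)ᴴ * H.map ι * (T : Matrix (Fin 3) (Fin 3) ℂ) = Literature.Geometry.ComplexHyperbolic.BallModel.J),
      (∀ τ' : L →+* ℂ, InfinitePlace.mk τ' ≠ InfinitePlace.mk ι → (H.map τ').PosDef) →
      2 ≤ Module.finrank ℚ ↥(maximalRealSubfield L) →
      ∀ (μ : Measure (adelicGroupData (↥(maximalRealSubfield L)) L (IsCMField.complexConj L) 3 H).automorphicQuotient)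
        [(adelicGroupData (↥(maximalRealSubfield L)) L (IsCMField.complexConj L) 3 H).IsAutomorphicMeasure μ]
        (P : DiscreteAutomorphicRep (adelicGroupData (↥(maximalRealSubfield L)) L (IsCMField.complexConj L) 3 H) μ)
        (Φ : (adelicGroupData (↥(maximalRealSubfield L)) L (IsCMField.complexConj L) 3 H).Adelic → (Fin 2 → ℂ)),
        Φ ∈ (CotangentForms.holCotForms (↥(maximalRealSubfield L)) L (IsCMField.complexConj L) 3 H (cmArchSection L ι H T hT)
          (cmCompactFactor L ι H T hT)).map (CotangentForms.conjFun (↥(maximalRealSubfield L)) L (IsCMField.complexConj L) 3 H) →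
        ∀ (h : ∀ j : Fin 2, MemLp (toQuotFun (adelicGroupData (↥(maximalRealSubfield L)) L (IsCMField.complexConj L) 3 H)
          fun x => Φ x j) 2 μ),
        ∃ Φ' ∈ (CotangentForms.holCotForms (↥(maximalRealSubfield L)) L (IsCMField.complexConj L) 3 H (cmArchSection L ι H T hT)
          (cmCompactFactor L ι H T hT)).map (CotangentForms.conjFun (↥(maximalRealSubfield L)) L (IsCMField.complexConj L) 3 H),
        ∃ h' : (∀ j : Fin 2, MemLp (toQuotFun (adelicGroupData (↥(maximalRealSubfield L)) L (IsCMField.complexConj L) 3 H)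
          fun x => Φ' x j) 2 μ),
        ∀ j : Fin 2, P.space.toSubmodule.starProjection ((h j).toLp _) =
          ((h' j).toLp _ : (adelicGroupData (↥(maximalRealSubfield L)) L (IsCMField.complexConj L) 3 H).L2 μ))
    (hcont : ∀ (F : HodgeCM.CMField) {ι₁ : F →+* ℂ} (V : HodgeCM.HermSpace3 F ι₁), 4 ≤ Module.finrank ℚ F →
      ∀ f ∈ cohForms (archFactorOf F V), ∀ j : Fin 2, Continuous fun x => f x j) :
    ∀ (hDel : Literature.AlgebraicGeometry.ShimuraVarieties.UnitaryCanonicalModel.canonicalModel_exists_printed)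
      (F : HodgeCM.CMField) [IsGalois ℚ F] (h6 : 6 ≤ Module.finrank ℚ F) {ι₁ : F →+* ℂ} (V : HodgeCM.HermSpace3 F ι₁) (a₀ : RealScalar F)
      (Φ : CMType F) (hΦ : ι₁ ∈ Φ.1) (i : (I V (repAt a₀) (muLiu ι₁ GramClass.rep))),
      3 ≤ (datum413 hDel F V a₀ Φ i).n → ∀ t : (datum413 hDel F V a₀ Φ i).AdmTriple,
        (∀ ψ : (datum413 hDel F V a₀ Φ i).omegaAt t →ₗ[ℂ] ((adelicDatum F V).Adelic → (Fin 2 → ℂ)),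
            (∀ (g : ↥(HodgeCM.HermSpace3.adelicFin V)) (w : (datum413 hDel F V a₀ Φ i).omegaAt t),
                ψ ((datum413 hDel F V a₀ Φ i).rhoAt t g w) = rightRep F V g (ψ w)) →
              (∀ w, ψ w ∈ holCotForms (archFactorOf F V)) → ψ = 0) ∨
        (∀ ψ : (datum413 hDel F V a₀ Φ i).omegaAt t →ₗ[ℂ] ((adelicDatum F V).Adelic → (Fin 2 → ℂ)),
            (∀ (g : ↥(HodgeCM.HermSpace3.adelicFin V)) (w : (datum413 hDel F V a₀ Φ i).omegaAt t),
                ψ ((datum413 hDel F V a₀ Φ i).rhoAt t g w) = rightRep F V g (ψ w)) →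
              (∀ w, ψ w ∈ (holCotForms (archFactorOf F V)).map (conjFun F V)) → ψ = 0) := by
  refine stubS5_of hE2' ?_ ?_ hcont
  · intro L _ _ _ ι H T hT hdef h2 μ _ P Φ hΦ h hu
    obtain ⟨j, hu⟩ := hu
    obtain ⟨Φ', hΦ', h', heq⟩ := hTPhol L ι H T hT hdef h2 μ P Φ hΦ h
    refine exists_ne_zero_containsForm_of_classes P hΦ' h' (fun j' => ?_) ⟨j, ?_⟩
    · rw [← heq j']
      exact Submodule.starProjection_apply_mem _ _
    · rw [← heq j, Submodule.starProjection_apply]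
      exact Subtype.coe_ne_coe.mpr (orthogonalProjectionOnto_ne_zero P.space hu)
  · intro L _ _ _ ι H T hT hdef h2 μ _ P Φ hΦ h hu
    obtain ⟨j, hu⟩ := hu
    obtain ⟨Φ', hΦ', h', heq⟩ := hTPantihol L ι H T hT hdef h2 μ P Φ hΦ h
    refine exists_ne_zero_containsForm_of_classes P hΦ' h' (fun j' => ?_) ⟨j, ?_⟩
    · rw [← heq j']
      exact Submodule.starProjection_apply_mem _ _
    · rw [← heq j, Submodule.starProjection_apply]
      exact Subtype.coe_ne_coe.mpr (orthogonalProjectionOnto_ne_zero P.space hu)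

end Summit.HodgeConjecture.HodgeConjecture.Cruxes.H413.F0P3StubS5Fold

end
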